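import Literature.NumberTheory.Transcendental.PadicCW77Main
import Literature.NumberTheory.Transcendental.Waldschmidt1980KStep
import Summits.ABC.StewartYu.PadicCW77HalfStep
import Summits.ABC.StewartYu.PadicW80SizesC
import Summits.ABC.StewartYu.PadicW80Budgets
import Summits.ABC.StewartYu.PadicW80ParF
import Summits.ABC.StewartYu.DescentSizesQ
import HarnessLib

/-!
# Cell abc-stewartyu, junctions J1/J2: p2's inputs `KSizes`, `Siegel`, `Endgame` in CLOSED FORM at
# p1's parameter record `PadicW80Par`

`Summits/ABC/StewartYu/PadicCW77Sizes.lean` — cell `abc-stewartyu` (HOME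
`run/shared/lean/pub/abc-stewartyu/`, seat p3; theorems only, no named fact), on top of p2's
`PadicCW77Main.lean` (the `Prop`s `Inv`, `KSizes`, `Siegel`, `Endgame` of a signed set-up
`S : PadicCW77.Setup`), p1's record `PadicW80Par` (`PadicW80Par{,B–F}.lean`: parameters,
`endgame_numbers`, `padic_siegel_count`), p2's height link `CW77.Setup.SizeHyp`, and p3's
`PadicW80Sizes(B,C).lean` (archimedean sizes), `PadicW80Budgets.lean` (closed forms `DmaxK`, `MmaxK`,
`PrVp`, `Efacp`), `PadicCW77HalfStep.lean` (`toQ`) and the sign-free descent files `DescentStepQ` /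
`DescentIntegralityQ` / `DescentSizesQ` (`SetupQ.Inv`, `SetupQ.siegel_step`, `SetupQ.w80_endgame`).

* **J1** `inv_iff` — p2's `S.Inv` and p3's `S.toQ.Inv` are the same `Prop` (fields `rfl`);
* `abs_cast_qTerm_eq_flat`, `exists_int_flatDclearJ_mul_qTerm` / `…_coreSum` — the signed term has
  the absolute value of the flattened one, so the flattening's clearing denominator `DclearJ♭` (the
  tree's `CW77.Setup.DclearJ`, integral on `qTerm♭` by `exists_int_DclearJ_mul_qTerm`) clears the SIGNED
  `coreSum` as well (`|x| = |z|, z ∈ ℤ ⟹ x ∈ ℤ`);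
* **`kSizes_of_hyp`** — `S.Inv … J p` with `|p| ≤ Pint ≤ PrV` ⟹ `S.KSizes J₀ J L L_θ S₀ T t p DmaxK MmaxK`
  (`D = DclearJ♭(s₁,τ) ≤ 𝔅²E(2^{k+1})` by `DclearJ_le_p`; `|coreSum| ≤ #box·PrV·max|qTerm|` by
  `abs_qTerm_le_p`, `card_box_le_𝔅_p`);
* **`siegel_of_hyp`** — `S.Siegel J₀ L L_θ S₀ T ⌈#box₀·𝔅⁴E(2)⌉` (p3's `SetupQ.siegel_step` + p1's
  count `padic_siegel_count` + `abs_Dclear_qTerm_le_p`, via `inv_iff`);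
* **`endgame_of_params`** — `S.Endgame J₀ L L_θ S₀ T Pint` (p3's `SetupQ.w80_endgame` + p1's
  `endgame_numbers`, `Lθ_lt_two_pow`, via `inv_iff`).

(p2's own `PadicCW77Siegel/Endgame.lean` prove the same two inputs from the p-adic side; this file
does not depend on them, which saves one landing layer.)  Everything is [folklore].
-/

noncomputable section

open Finset
open Literature.NumberTheory.Transcendental
open Literature.NumberTheory.Transcendental.CW77 (heightProd hgt)
open Literature.NumberTheory.Transcendental.CW77.Setup (Idx Tau tauNorm tauSet)

namespace Literature.NumberTheory.Transcendental.PadicCW77.Setup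

open Summit.ABC.StewartYu
open Summit.ABC.StewartYu.PadicW80Par (cLp')

variable (S : PadicCW77.Setup) {h Lb : ℕ}

/-! ### J1: the two invariants coincide -/

/-- **J1: p2's `Inv` and the sign-free `SetupQ.Inv` of `S.toQ` are the same** (`frame.box = flat.box`,
`coreSum = toQ.coreSum` definitionally). [folklore] -/
theorem inv_iff {J₀ : ℕ} {L : Fin S.d → ℕ} {Lθ S₀ T : ℕ} {P : ℤ} {J : ℕ} {p : Idx S.d h Lb → ℤ} :
    S.Inv J₀ L Lθ S₀ T P J p ↔ S.toQ.Inv J₀ L Lθ S₀ T P J p :=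
  ⟨fun hI => ⟨hI.supp, hI.nonzero, hI.bound, hI.rel⟩, fun hI => ⟨hI.supp, hI.nonzero, hI.bound, hI.rel⟩⟩

/-! ### Sign transfer: absolute values and integrality -/

/-- `|qTerm|` of the signed set-up is `|qTerm♭|` (real casts). [folklore] -/
theorem abs_cast_qTerm_eq_flat (J₀ J : ℕ) (u : Idx S.d h Lb) (τ : Tau S.d) (s : ℕ) :
    |(S.qTerm J₀ J u τ s : ℝ)| = |(S.toQ.flat.qTerm J₀ J u τ s : ℝ)| := by
  rw [← S.toQ_qTerm, ← Rat.cast_abs, ← Rat.cast_abs, S.toQ.abs_qTerm]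

/-- **`DclearJ♭(s,τ) · qTerm_J(u,τ,s) ∈ ℤ`** for the SIGNED term on the box of level `J`: the flattened
product is an integer (tree: `CW77.Setup.exists_int_DclearJ_mul_qTerm`) and the signed one has the same
absolute value. [folklore] -/
theorem exists_int_flatDclearJ_mul_qTerm (J₀ J : ℕ) {L : Fin S.d → ℕ} {Lθ : ℕ} {u : Idx S.d h Lb}
    (hu : u ∈ S.frame.box (h := h) (Lb := Lb) L Lθ J) (τ : Tau S.d) (s : ℕ) :
    ∃ z : ℤ, ((S.toQ.flat.DclearJ (h := h) J₀ J L Lθ s τ : ℕ) : ℚ) * S.qTerm J₀ J u τ s = z := by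
  obtain ⟨z, hz⟩ := S.toQ.flat.exists_int_DclearJ_mul_qTerm J₀ J (u := u) hu τ s
  have habs : |((S.toQ.flat.DclearJ (h := h) J₀ J L Lθ s τ : ℕ) : ℚ) * S.qTerm J₀ J u τ s| = |(z : ℚ)| := by
    rw [← hz, abs_mul, abs_mul, ← S.toQ_qTerm, S.toQ.abs_qTerm]
  rcases abs_eq_abs.mp habs with h1 | h1
  · exact ⟨z, h1⟩
  · exact ⟨-z, by rw [h1]; push_cast; ring⟩

/-- **`DclearJ♭(s,τ) · coreSum_J(τ,s) ∈ ℤ`** for coefficients supported... summed over the box of level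
`J` (every term is an integer). [folklore] -/
theorem exists_int_flatDclearJ_mul_coreSum (J₀ J : ℕ) (L : Fin S.d → ℕ) (Lθ : ℕ)
    (p : Idx S.d h Lb → ℤ) (τ : Tau S.d) (s : ℕ) :
    ∃ m : ℤ, ((S.toQ.flat.DclearJ (h := h) J₀ J L Lθ s τ : ℕ) : ℚ) *
      S.coreSum J₀ J (S.frame.box (h := h) (Lb := Lb) L Lθ J) p τ s = m := by
  classical
  have hint : ∀ u ∈ S.frame.box (h := h) (Lb := Lb) L Lθ J, ∃ z : ℤ,
      ((S.toQ.flat.DclearJ (h := h) J₀ J L Lθ s τ : ℕ) : ℚ) * S.qTerm J₀ J u τ s = z :=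
    fun u hu => S.exists_int_flatDclearJ_mul_qTerm J₀ J hu τ s
  choose! z hz using hint
  refine ⟨∑ u ∈ S.frame.box (h := h) (Lb := Lb) L Lθ J, p u * z u, ?_⟩
  unfold coreSum
  rw [mul_sum]
  push_cast
  refine sum_congr rfl fun u hu => ?_
  rw [← hz u hu]; ring

variable {S}
variable {P : PadicW80Par S.d} (hy : S.toQ.flat.SizeHyp P.Vs P.Vel P.Wb)
include hy

/-! ### J2 (inner steps): `KSizes` in closed form -/

omit hy in
/-- `4 · (2^{k+J} S₀ / 2) = 2^{k+1+J} S₀` (`S₀` is even). [folklore] -/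
theorem four_mul_kptsp (P : PadicW80Par S.d) (J k : ℕ) :
    4 * (2 ^ (k + J) * P.S₀p / 2) = 2 ^ (k + 1 + J) * P.S₀p := by
  obtain ⟨m, hm⟩ := P.even_S₀
  rw [hm, ← two_mul, show 2 ^ (k + J) * (2 * m) = 2 ^ (k + J) * m * 2 by ring,
    Nat.mul_div_cancel _ two_pos]
  ring

/-- **J2, the archimedean sizes of the inner steps in closed form.** For coefficients `p` of level
`J < J₀` with `|p(u)| ≤ Pint ≤ PrV`: at step `k < d`, `|τ| + t ≤ T/2^J − kt`, odd `s₁ < 2^{k+1+J}S₀`,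
the integer `D = DclearJ♭(s₁,τ) ≤ Dmax_k` clears `coreSum` and `|coreSum| ≤ Mmax_k`. [folklore] -/
theorem kSizes_of_hyp {J : ℕ} (hJ : J < P.J₀p) (t : ℕ) {Pint : ℤ} (hPint : (Pint : ℝ) ≤ P.PrVp)
    {p : Idx S.d P.hparp P.Lbp → ℤ} (inv : S.Inv P.J₀p P.Lp P.Lθp P.S₀p P.Tp Pint J p) :
    S.KSizes P.J₀p J P.Lp P.Lθp P.S₀p P.Tp t p P.DmaxK P.MmaxK := by
  classical
  intro k hk τ hτ s₁ hs₁ _hodd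
  have hPr : (0 : ℝ) ≤ P.PrVp := by linarith [P.one_le_PrVp]
  have hτT : tauNorm τ ≤ P.Tp := by have := Nat.div_le_self P.Tp (2 ^ J); omega
  have hs4 : s₁ < 2 ^ (k + 1 + J) * P.S₀p := by rw [← four_mul_kptsp P J k]; exact hs₁
  have hB0 : 0 ≤ P.DmaxK k := (P.DmaxK_pos k).le
  refine ⟨S.toQ.flat.DclearJ (h := P.hparp) P.J₀p J P.Lp P.Lθp s₁ τ, S.toQ.flat.DclearJ_pos _ _ _ _ _ _,
    ?_, S.exists_int_flatDclearJ_mul_coreSum P.J₀p J P.Lp P.Lθp p τ s₁, ?_⟩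
  · have := hy.DclearJ_le_p hJ.le hk.le hτT hs4
    unfold PadicW80Par.DmaxK PadicW80Par.Efacp; exact this
  · have hterm : ∀ u ∈ S.frame.box (h := P.hparp) (Lb := P.Lbp) P.Lp P.Lθp J,
        |(p u : ℝ)| * |(S.qTerm P.J₀p J u τ s₁ : ℝ)| ≤ P.PrVp * P.DmaxK k := by
      intro u hu
      have hq : |(S.qTerm P.J₀p J u τ s₁ : ℝ)| ≤ P.DmaxK k := by
        rw [S.abs_cast_qTerm_eq_flat]
        have := hy.abs_qTerm_le_p hJ.le hk.le (u := u) hu hτT hs4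
        unfold PadicW80Par.DmaxK PadicW80Par.Efacp; exact this
      have hp : |(p u : ℝ)| ≤ P.PrVp := le_trans (by exact_mod_cast inv.bound u) hPint
      exact mul_le_mul hp hq (abs_nonneg _) hPr
    have hcard : ((S.frame.box (h := P.hparp) (Lb := P.Lbp) P.Lp P.Lθp J).card : ℝ) ≤ P.𝔅p :=
      S.toQ.flat.card_box_le_𝔅_p P J
    show |((S.coreSum P.J₀p J _ p τ s₁ : ℚ) : ℝ)| ≤ P.MmaxK k
    unfold coreSum PadicW80Par.MmaxK
    push_cast
    calc |∑ u ∈ S.frame.box (h := P.hparp) (Lb := P.Lbp) P.Lp P.Lθp J, (p u : ℝ) * (S.qTerm P.J₀p J u τ s₁ : ℝ)|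
        ≤ ∑ u ∈ S.frame.box (h := P.hparp) (Lb := P.Lbp) P.Lp P.Lθp J, |(p u : ℝ) * (S.qTerm P.J₀p J u τ s₁ : ℝ)| :=
          abs_sum_le_sum_abs _ _
      _ ≤ ∑ u ∈ S.frame.box (h := P.hparp) (Lb := P.Lbp) P.Lp P.Lθp J, P.PrVp * P.DmaxK k :=
          sum_le_sum fun u hu => by rw [abs_mul]; exact hterm u hu
      _ = (S.frame.box (h := P.hparp) (Lb := P.Lbp) P.Lp P.Lθp J).card * (P.PrVp * P.DmaxK k) := by
          rw [sum_const, nsmul_eq_mul]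
      _ ≤ P.𝔅p * (P.PrVp * P.DmaxK k) := mul_le_mul_of_nonneg_right hcard (mul_nonneg hPr hB0)
      _ = P.𝔅p * P.PrVp * P.DmaxK k := by ring

/-! ### Siegel and the endgame at p1's parameters, via the sign-free descent files -/

/-- **The input `Siegel` in closed form**: integers `p(u)` of level `0`, `|p(u)| ≤ ⌈#box₀ · 𝔅⁴E(2)⌉`
(`SetupQ.siegel_step` with the count `padic_siegel_count` and `Amax = 𝔅⁴E(2)` from
`abs_Dclear_qTerm_le_p`). [folklore] -/
theorem siegel_of_hyp :
    S.Siegel (h := P.hparp) (Lb := P.Lbp) P.J₀p P.Lp P.Lθp P.S₀p P.Tp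
      ⌈((S.frame.box (h := P.hparp) (Lb := P.Lbp) P.Lp P.Lθp 0).card : ℝ) * (P.𝔅p ^ 4 * P.Efacp 2)⌉ := by
  have hS₀ : 1 ≤ P.S₀p := le_trans (by norm_num) P.two_le_S₀
  have hAmax : 1 ≤ P.𝔅p ^ 4 * P.Efacp 2 :=
    one_le_mul_of_one_le_of_one_le (one_le_pow₀ P.one_le_𝔅) (P.one_le_Efacp (by norm_num))
  have hA : ∀ s, s < P.S₀p → ∀ τ : Tau S.d, tauNorm τ < P.Tp →
      ∀ u ∈ S.toQ.flat.box (h := P.hparp) (Lb := P.Lbp) P.Lp P.Lθp 0,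
      |((S.toQ.flat.Dclear (h := P.hparp) P.J₀p P.Lp P.Lθp s τ : ℕ) : ℝ) * (S.toQ.qTerm P.J₀p 0 u τ s : ℝ)| ≤
        P.𝔅p ^ 4 * P.Efacp 2 := by
    intro s hs τ hτ u hu
    rw [abs_mul, S.toQ_qTerm, S.abs_cast_qTerm_eq_flat, ← abs_mul]
    have := hy.abs_Dclear_qTerm_le_p hs hτ hu
    unfold PadicW80Par.Efacp; exact this
  obtain ⟨p, hp⟩ := S.toQ.siegel_step P.J₀p P.Lp P.Lθp P.S₀p P.Tp hS₀ P.one_le_T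
    (PadicW80Par.padic_siegel_count S.toQ.flat P) hAmax hA
  exact ⟨p, (S.inv_iff).mpr hp⟩

omit hy in
/-- **The input `Endgame` at p1's parameters** (`SetupQ.w80_endgame` with p1's `endgame_numbers` and
`Lθ_lt_two_pow`). [folklore] -/
theorem endgame_of_params (P : PadicW80Par S.d) (Pint : ℤ) :
    S.Endgame (h := P.hparp) (Lb := P.Lbp) P.J₀p P.Lp P.Lθp P.S₀p P.Tp Pint := by
  intro p inv
  obtain ⟨h1, h2⟩ := P.endgame_numbers
  have hT' : (P.Tp / 2 ^ P.J₀p - ∑ j, P.Lp j / 2 ^ P.J₀p) + ∑ j, P.Lp j / 2 ^ P.J₀p ≤ P.Tp / 2 ^ P.J₀p := by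
    omega
  exact S.toQ.w80_endgame ((S.inv_iff).mp inv) P.Lθ_lt_two_pow
    (T' := P.Tp / 2 ^ P.J₀p - ∑ j, P.Lp j / 2 ^ P.J₀p) hT' h2

end Literature.NumberTheory.Transcendental.PadicCW77.Setup

end
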